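import Literature.Topology.FourManifolds.BordismFourFiniteness
import HarnessLib

/-!
# Thom (1952), Thm V.10 in dimension four, from Lefschetz and Poincaré duality alone
(proof file for `Literature.Topology.FourManifolds.exists_isotropic_of_isOrientedBordant_of_isEmpty`)

Sibling proof file of `Literature.Topology.FourManifolds.BordismFourProofs` (where the named fact
`exists_isotropic_of_isOrientedBordant_of_isEmpty` — R. Thom, *Espaces fibrés en sphères et carrés
de Steenrod*, Ann. Sci. ENS 69 (1952), **Thm V.10** (p. 176) for `k = 1`: the cup form on
`H²(P; ℤ)/T` of a closed smooth `ℤ`-oriented 4-manifold which is an oriented boundary has an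
isotropic submodule of half rank — is stated and proved from Thom's Cor. V.8,
`exists_isotropic_of_isOrientedBordant_of_isEmpty_of`) and of
`Literature.Topology.FourManifolds.BordismFourFiniteness` (where Cor. V.8,
`two_mul_boundaryImageRank_eq`, is proved from Lefschetz duality and Poincaré duality alone,
`two_mul_boundaryImageRank_eq_of_duality'`).

The printed proof (p. 176): "Si `V` est une variété-bord, on a `Φ(x, x) = 0` pour toute classe
`x ∈ A^{2k}`; or d'après le théorème V.8, le rang de `A^{2k}` est égal à `½ b^{2k}(V)`", where
`A = f^* H^*(M) ⊂ H^*(V)` for `V = ∂M` (Def. p. 175: `M` compact orientable with `∂m = v`), the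
isotropy of `A^{2k}` is the easy half of Thm V.7 and Cor. V.8 (`r_p + r_{n-p} = b_p(V)`, p. 173)
comes from Thm V.7, i.e. from the duality theorem for manifolds with boundary (Thm V.4,
Cor. V.5 — Poincaré–Lefschetz duality) and Poincaré duality of `V`.

Composing the two proved edges records Thm V.10 (dimension four) with exactly the two textbook
duality theorems as remaining inputs, both standing named facts of
`Literature.AlgebraicTopology.SingularHomology`:

* `hL` — Lefschetz duality for compact 5-manifolds with boundary carrying a relative fundamental
  class, `bijective_relCapProduct_of_isRelFundamentalClass` (Spanier Thm. 6.3.12 = Hatcher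
  Thm. 3.43; `…LefschetzDuality`);
* `hD` — Poincaré duality for closed `ℤ`-oriented 4-manifolds, `bijective_poincareDualityMap`
  (Hatcher Thm. 3.30; `…PoincareDuality`).

Everything else on Thom's path (fundamental classes, the normalization of a homological bordism
datum, universal coefficients, all finiteness statements, the duality ladder "half lives, half
dies", the isotropy of `A²`) is a theorem of `Literature`.  No new definitions, no named facts.

## References

* R. Thom, *Espaces fibrés en sphères et carrés de Steenrod*, Ann. Sci. ENS 69 (1952) 109–182:
  Thm V.4–Cor. V.5 (p. 172–173), Thm V.7 and Cor. V.8 (p. 173), Def. of "variété-bord" (p. 175),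
  Thm V.10 (p. 176). [Thom1952]
* A. Hatcher, *Algebraic Topology*, CUP 2002, Thm. 3.30, Thm. 3.43. [Hatcher2002]
* E. H. Spanier, *Algebraic Topology*, Springer 1981, Ch. 6 §3 Thm. 12. [Spanier1981]
-/

noncomputable section

open scoped Manifold ContDiff Topology

universe u

namespace Literature.Topology.FourManifolds

section SPC4

/-- **Thom (1952), Thm V.10 in dimension four, from Lefschetz duality and Poincaré duality
alone.**  If `hL` (Spanier Thm. 6.3.12: `a ↦ a ⌢ z : H²(W; ℤ) → H₃(W, ∂W; ℤ)` is bijective for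
every compact topological 5-manifold with boundary `W` and relative fundamental class `z`) and
`hD` (Hatcher Thm. 3.30: `a ↦ a ⌢ [P] : H²(P; ℤ) → H₂(P; ℤ)` is bijective for every closed
`ℤ`-oriented topological 4-manifold) hold, then for every closed smooth `ℤ`-oriented 4-manifold
`(P, π)` which is an oriented boundary (`IsOrientedBordant 4 π ν` with the second end empty —
Thom's "variété-bord", p. 175) the lattice `H²(P; ℤ)/T` contains a submodule `K` with
`Q_π(x, x) = 0` on `K` and `2 · rank K = rank H²(P; ℤ)/T`.  PROVED: Cor. V.8 from `hL`, `hD`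
(`two_mul_boundaryImageRank_eq_of_duality'`), then V.8 ⟹ V.10
(`exists_isotropic_of_isOrientedBordant_of_isEmpty_of`: with `N = ∅` the isotropic
`A² = i^* H²(W) ⊆ H²(P; ℤ)/T ⊕ 0` has rank `r₂ = ½ b₂(P)`). [cite: Thom1952, Thm V.10 (p. 176)] -/
theorem exists_isotropic_of_isOrientedBordant_of_isEmpty_of_duality
    (hL : ∀ {W : Type u} [TopologicalSpace W] [T2Space W] [CompactSpace W]
      [ChartedSpace (EuclideanHalfSpace (4 + 1)) W]
      (z : ↥(Literature.AlgebraicTopology.SingularHomology.relativeSingularHomology ℤ ℤ W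
        ((𝓡∂ (4 + 1)).boundary W) (4 + 1)))
      (hz : Literature.AlgebraicTopology.SingularHomology.IsRelFundamentalClass ℤ
        ((𝓡∂ (4 + 1)).boundary W) z),
      Literature.AlgebraicTopology.SingularHomology.bijective_relCapProduct_of_isRelFundamentalClass
        ℤ 4 W z hz (show 2 + (2 + 1) = 4 + 1 by rfl))
    (hD : ∀ {P : Type u} [TopologicalSpace P] [T2Space P] [CompactSpace P]
      [ChartedSpace (EuclideanSpace ℝ (Fin 4)) P]
      (π : Literature.AlgebraicTopology.SingularHomology.HomologicalOrientation ℤ P 4),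
      Literature.AlgebraicTopology.SingularHomology.bijective_poincareDualityMap π
        two_add_two_eq_four) :
    exists_isotropic_of_isOrientedBordant_of_isEmpty.{u} :=
  exists_isotropic_of_isOrientedBordant_of_isEmpty_of (two_mul_boundaryImageRank_eq_of_duality' hL hD)

end SPC4

end Literature.Topology.FourManifolds

end
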